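import Mathlib
import Summits.Ventures.PercRepro2.CoincA3Main
import Summits.Ventures.PercRepro2.PocketBHK

/-!
# The glued half of the first-order coefficient at `a₃ = o` is a BHK bracket (blind cell
PercRepro2, night-1 g17; NIGHT1-G17.md §4′)

At the coincidence `a₃ = o` the masses of the cleared mean field reduce to the nine cells of
`(o, b)` under `Q`; the bracket `B₂ = Z · (M₂ + Δ_T) − gap · P(Q, o ∈ C₂)` of the glued instance
(the coefficient of `2 D_o⁰` in the first-order coefficient `Φ_o(1)` of `OEdge.HMFc_eq_factor_o`)
is `Z · P(Q, o ∉ U, bH) + [Z · P(Q, oH, bH) − P(Q, oH) P(Q, bH)] − [Z · P(Q, oH, bL) − P(Q, oH) P(Q, bL)]`: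
a nonnegative mass, a same-cluster BHK slack and a cross-cluster BHK slack.

* **`B2_nonneg`**: `0 ≤ Z · (M₂ + Δ_T) − gap · P(Q, o ∈ C₂)` at `a₃ = o`, for every graph and every
  weight vector (`bhk_same_cluster_events`, `bhk_cross_cluster` of the tree).

Own code; standard axioms.
-/

namespace Summit.Ventures.PercRepro2

open UnionCluster CovForm

namespace OEdge

section B2

variable {V : Type*} {E : Type*} [Fintype E] [DecidableEq E] [Fintype V] [DecidableEq V]
  {R : Type*} [Field R] [LinearOrder R] [IsStrictOrderedRing R]

variable (p : E → R) (ends : E → Sym2 V) (o a₁ a₂ b : V)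

omit [Fintype E] [DecidableEq E] [Fintype V] [DecidableEq V] [LinearOrder R]
  [IsStrictOrderedRing R] in
/-- `{C(x) ∋ v} = {x ↔ v}`. -/
lemma clusterIn_eq (x v : V) : clusterInEvent ends x {S : Set V | v ∈ S} = connEvent ends x v := by
  ext ω
  simp [clusterInEvent, cluster, connEvent]

omit [Fintype E] [DecidableEq E] [Fintype V] [DecidableEq V] [LinearOrder R]
  [IsStrictOrderedRing R] in
/-- `Q` as the complement of `{a₂ ↔ a₁}`. -/
lemma Q_eq_compl : avoidAll ends a₂ {a₁} = (connEvent ends a₂ a₁)ᶜ := by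
  rw [PendantRoot.avoidAll_eq_compl, connEvent_comm]

/-- **The glued bracket is nonnegative**: at `a₃ = o`,
`0 ≤ P(Q) · (M₂ + Δ_T) − gap · P(Q, o ∈ C₂)`. -/
theorem B2_nonneg (hp : IsProbVec p) :
    0 ≤ prob p (avoidAll ends a₂ {a₁}) * (massM2 p ends a₁ a₂ o b + deltaT p ends a₁ a₂ o b) -
      gap p ends a₁ a₂ b * prob p (avoidAll ends a₂ {a₁} ∩ connEvent ends a₂ o) := by
  have hup : ∀ v : V, IsUpperSet {S : Set V | v ∈ S} := fun v _ _ hST h => hST h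
  have hsame := bhk_same_cluster_events p hp ends a₂ a₁ (hup o) (hup b)
  have hcross := bhk_cross_cluster p hp ends a₂ a₁ (hup o) (hup b)
  rw [clusterIn_eq, clusterIn_eq, ← Q_eq_compl] at hsame hcross
  have hgap := gap_eq_Q p ends a₁ a₂ b
  unfold massM2 deltaT
  rw [(Coinc.T_o_eq ends o a₁ a₂).1, hgap]
  -- the three events in a canonical order
  have e1 : connEvent ends a₂ b ∩ (avoidAll ends a₂ {a₁} ∩ connEvent ends a₂ o) =
      connEvent ends a₂ o ∩ connEvent ends a₂ b ∩ avoidAll ends a₂ {a₁} := by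
    ext ω; simp only [Set.mem_inter_iff]; tauto
  have e2 : connEvent ends a₁ b ∩ (avoidAll ends a₂ {a₁} ∩ connEvent ends a₂ o) =
      connEvent ends a₂ o ∩ connEvent ends a₁ b ∩ avoidAll ends a₂ {a₁} := by
    ext ω; simp only [Set.mem_inter_iff]; tauto
  have e3 : connEvent ends a₂ o ∩ avoidAll ends a₂ {a₁} =
      avoidAll ends a₂ {a₁} ∩ connEvent ends a₂ o := Set.inter_comm _ _
  have e4 : connEvent ends a₂ b ∩ avoidAll ends a₂ {a₁} =
      avoidAll ends a₂ {a₁} ∩ connEvent ends a₂ b := Set.inter_comm _ _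
  have e5 : connEvent ends a₁ b ∩ avoidAll ends a₂ {a₁} =
      avoidAll ends a₂ {a₁} ∩ connEvent ends a₁ b := Set.inter_comm _ _
  rw [e1, e2]
  rw [e3, e4] at hsame
  rw [e3, e5] at hcross
  have hM : 0 ≤ prob p (PDEvent ends a₁ a₂ o ∩ connEvent ends a₂ b) := prob_nonneg hp _
  have hZ : 0 ≤ prob p (avoidAll ends a₂ {a₁}) := prob_nonneg hp _
  nlinarith [hsame, hcross, mul_nonneg hZ hM]

end B2

end OEdge

end Summit.Ventures.PercRepro2
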